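/-
Origin: written from primary sources — A. Weil, *Sur certains groupes d'opérateurs unitaires*, Acta Math. 111 (1964) Chap. III
n° 41, Lemme 5 p. 194 (majorants on compact sets), Théorème 6 (1) p. 193; R. Howe, *θ-series and invariant theory* (1979) §3;
S. Kudla, *Seesaw dual reductive pairs* (1984) §1 (see-saw partner of a non-trivially embedded orthogonal decomposition);
S. Gelbart, J. Rogawski, Invent. Math. 105 (1991) §3.1 Prop. 3.1.1 p. 455, Remark p. 457 L4–13. Adapted: no. This file is the
sibling of `UnitaryDualPairSeesawCMLinesMajorants` for the CONJUGATED plane of `UnitaryDualPairSeesawCMLinesConj`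
(`cmConjLineRepRaw₀/₁`, `cmConjLineRep₀/₁ η_k`, `cmConjLineRepFin₀/₁ η_k`; `g = g₀ ⊗ 1`, `C = 1 ⊗ diag(bᵢ/aᵢ) ⊗ 1`): the `(34)`
majorant dischargers of `UnitaryDualPairSeesawConjMajorants` at these data, and their sign-discharged forms. Kernel only; no
records; nothing cited as a hypothesis.
-/
import Literature.NumberTheory.GelbartRogawski1991.UnitaryDualPairSeesawCMLinesMajorants
import Literature.NumberTheory.GelbartRogawski1991.UnitaryDualPairSeesawCMLinesConj
import HarnessLib

/-!
# Weil majorants for the conjugated CM line representations `cmConjLineRep{Raw,,Fin}₀/₁` (the `(34)` see-saw at `g = g₀ ⊗ 1`)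

Setting of `UnitaryDualPairSeesawCMLinesConj`: CM field `L`, `V = diag(dV)` of rank `N`, the plane `W = diag(a₀, a₁)` carrying the
big pair `(U(V), U(W))` with its chosen compatible splitting `splittingOf hGR`, a SECOND diagonal plane `W′ = diag(b₀, b₁)` isometric
to `W` through a rational `g₀ ∈ GL₂(L)` (`ᵗḡ₀ · diag(a) · g₀ = diag(b)`, hypothesis `hg₀`), the line pairs `(U(V), U(⟨b_k⟩))` with
chosen compatible splittings `splittingOf hGR₀`, `splittingOf hGR₁` ([GelbartRogawski1991, Prop. 3.1.1]), and the line
representations `cmConjLineRepRaw_k = ω_k″` (K-1's renormalised `seesawConjRep₁/₂` at `g = g₀ ⊗ 1`), `cmConjLineRep_k η_k`,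
`cmConjLineRepFin_k η_k` (lines `k = 2, 3` of the Hodge-CM period packet).

* §1 **`hasThetaMajorants_cmConjLineRepRaw₀/₁`** (= `hM₃`/`hM₄` of `UnitaryDualPairSeesawConjMajorants` at the conjugated CM data)
  from the three CM-currency majorant hypotheses `hρ` (big pair of the FIRST plane), `hρ₀`, `hρ₁` (line pairs of the SECOND
  plane) — the hypothesis block of `UnitaryDualPairSeesawCMLinesConjDeepLevelFixed` verbatim; **`hasThetaMajorants_cmConjLineRep₀/₁`**
  (+ `Continuous η_k`; `hasThetaMajorants_twist_comp_center`), **`hasThetaMajorants_cmConjLineRepFin₀/₁`**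
  (`hasThetaMajorants_reindexConj_comp_relNormOne`) [Weil1964, Lemme 5];
* §2 NO MAJORANT HYPOTHESIS LEFT: **`hasThetaMajorants_cmConjLineRepFin₀/₁_of_signs`** from the sign facts `(ι₁, h₁V, h₁W, hV)`
  of `V` and of the FIRST plane `diag(a)` and `Continuous η_k` (`Weil1964.hasThetaMajorants_cmPairSplitting_of_signs_two` for
  `hρ`; `hasThetaMajorants_omega_pairSmall₁/₂_lineVec_of_signs` at the lines `⟨b_k⟩` for `hρ₀`/`hρ₁` — a line has a strict sign
  through every embedding, so NOTHING is asked of `b`).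

Provenance / use (Hodge-CM model-construction cell, BINDER-OWNERS rows `real34` / `S`): `((S V c).P k).ω = lineRepOf k`, `k = 2, 3`,
of `HodgeCM/Model/ArchSideTerm.lean` are `cmConjLineRepFin₀/₁ η₂/η₃` at `(b, g₀) := (dW′, isoGL)` pulled back along the continuous
inclusion `regimeSubgroup ↪ U(diag dV)(𝔸)`; §2 is the tree supply for the MAJORANT field of theta-3's `restrictTwist (lineRepOf k)`.
Nothing here is a claim of the manuscripts under adjudication: kernel analysis over the tree's constructed objects.
-/

set_option autoImplicit false

noncomputable section

open scoped Matrix Kronecker Topology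
open NumberField
open Literature.RepresentationTheory Literature.RepresentationTheory.SeesawScalar
open Literature.NumberTheory.Automorphic
open Literature.NumberTheory.Automorphic.UnitaryGroup
open Literature.NumberTheory.Weil1964

namespace Literature.NumberTheory.GelbartRogawski1991

namespace UnitaryDualPair

/-! ## §1 The `(34)` dischargers in conjugated CM-lines currency -/

section CMLinesConj

variable (L : Type) [Field L] [NumberField L] [IsCMField L] {N n n₁ : ℕ}
  (e : Fin N × Fin 2 ≃ Fin n) (e₁ : Fin N × Fin 1 ≃ Fin n₁)
variable (dV : Fin N → L) (hdV : ∀ i, IsCMField.complexConj L (dV i) = dV i) (hdV0 : ∀ i, dV i ≠ 0)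
variable (a : Fin 2 → L) (ha : ∀ i, IsCMField.complexConj L (a i) = a i) (ha0 : ∀ i, a i ≠ 0)
variable (b : Fin 2 → L) (hb : ∀ i, IsCMField.complexConj L (b i) = b i) (hb0 : ∀ i, b i ≠ 0) (g₀ : GL (Fin 2) L)
  (hg₀ : ((g₀ : Matrix (Fin 2) (Fin 2) L).map (IsCMField.complexConj L : L →+* L))ᵀ * Matrix.diagonal a *
    (g₀ : Matrix (Fin 2) (Fin 2) L) = Matrix.diagonal b)
variable (hGR : (cmSplittingDatum L e dV hdV hdV0 a ha ha0).CompatibleSplitting)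
  (hGR₀ : (cmSplittingDatum L e₁ dV hdV hdV0 (lineVec L (b 0)) (fun _ => hb 0) (fun _ => hb0 0)).CompatibleSplitting)
  (hGR₁ : (cmSplittingDatum L e₁ dV hdV hdV0 (lineVec L (b 1)) (fun _ => hb 1) (fun _ => hb0 1)).CompatibleSplitting)
  (η₀ η₁ : CMAdelic L dV × CMAdelicOne L →* ℂˣ)

/-! Weil's majorant hypotheses at the CM data of the second plane (the block of `UnitaryDualPairSeesawCMLinesConjDeepLevelFixed`):
`hρ` for the big pair `ω_ψ ∘ s_pair` of `(U(diag dV), U(diag a))`, `hρ₀`, `hρ₁` for the two line pairs at `⟨b₀⟩, ⟨b₁⟩`. -/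
variable
  (hρ : HasThetaMajorants fun (p : CMAdelic L dV × CMAdelic L a)
      (Φ : piSchwartzBruhat (↥(maximalRealSubfield L)) (Fin n)) =>
    adelicMpCont.omega (↥(maximalRealSubfield L)) (Fin n)
      (adelicGram (↥(maximalRealSubfield L)) e (realDiagonal L dV hdV) (realDiagonal L a ha))
      (cmPairSplitting L e dV hdV hdV0 a ha ha0 hGR p) Φ)
  (hρ₀ : HasThetaMajorants fun (p : CMAdelic L dV × CMAdelic L (lineVec L (b 0)))
      (Φ : piSchwartzBruhat (↥(maximalRealSubfield L)) (Fin N × Fin 1)) =>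
    adelicMpCont.omega (↥(maximalRealSubfield L)) (Fin N × Fin 1)
      ((realDiagonal L dV hdV).map (algebraMap (↥(maximalRealSubfield L))
          (AdeleRing (𝓞 ↥(maximalRealSubfield L)) ↥(maximalRealSubfield L))) ⊗ₖ
        (realDiagonal L (lineVec L (b 0)) fun _ => hb 0).map (algebraMap (↥(maximalRealSubfield L))
          (AdeleRing (𝓞 ↥(maximalRealSubfield L)) ↥(maximalRealSubfield L))))
      (pairSmall₁ (↥(maximalRealSubfield L)) L (IsCMField.complexConj L) N 1 e₁ (Matrix.diagonal dV)
        (Matrix.diagonal (lineVec L (b 0)))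
        (splittingOf (↥(maximalRealSubfield L)) L (IsCMField.complexConj L) N 1 e₁ (Matrix.diagonal dV)
          (Matrix.diagonal (lineVec L (b 0))) (complexConj_imagUnit L) (imagUnit_ne_zero L) (imagUnit_mul_self L)
          (realDiagonal_isSymm L dV hdV) (realDiagonal_isSymm L (lineVec L (b 0)) fun _ => hb 0)
          (isUnit_det_realDiagonal L dV hdV hdV0) (isUnit_det_realDiagonal L (lineVec L (b 0)) (fun _ => hb 0) fun _ => hb0 0)
          (realDiagonal_map L dV hdV).symm (realDiagonal_map L (lineVec L (b 0)) fun _ => hb 0).symm hGR₀) p) Φ)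
  (hρ₁ : HasThetaMajorants fun (p : CMAdelic L dV × CMAdelic L (lineVec L (b 1)))
      (Φ : piSchwartzBruhat (↥(maximalRealSubfield L)) (Fin N × Fin 1)) =>
    adelicMpCont.omega (↥(maximalRealSubfield L)) (Fin N × Fin 1)
      ((realDiagonal L dV hdV).map (algebraMap (↥(maximalRealSubfield L))
          (AdeleRing (𝓞 ↥(maximalRealSubfield L)) ↥(maximalRealSubfield L))) ⊗ₖ
        (realDiagonal L (lineVec L (b 1)) fun _ => hb 1).map (algebraMap (↥(maximalRealSubfield L))
          (AdeleRing (𝓞 ↥(maximalRealSubfield L)) ↥(maximalRealSubfield L))))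
      (pairSmall₂ (↥(maximalRealSubfield L)) L (IsCMField.complexConj L) N 1 e₁ (Matrix.diagonal dV)
        (Matrix.diagonal (lineVec L (b 1)))
        (splittingOf (↥(maximalRealSubfield L)) L (IsCMField.complexConj L) N 1 e₁ (Matrix.diagonal dV)
          (Matrix.diagonal (lineVec L (b 1))) (complexConj_imagUnit L) (imagUnit_ne_zero L) (imagUnit_mul_self L)
          (realDiagonal_isSymm L dV hdV) (realDiagonal_isSymm L (lineVec L (b 1)) fun _ => hb 1)
          (isUnit_det_realDiagonal L dV hdV hdV0) (isUnit_det_realDiagonal L (lineVec L (b 1)) (fun _ => hb 1) fun _ => hb0 1)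
          (realDiagonal_map L dV hdV).symm (realDiagonal_map L (lineVec L (b 1)) fun _ => hb 1).symm hGR₁) p) Φ)

include hρ hρ₀ hρ₁ in
/-- **`hM₃` at the conjugated CM data — Weil majorants for `ω₀″ = cmConjLineRepRaw₀`** (`hasThetaMajorants_seesawConjRep₁` at
`g = g₀ ⊗ 1`, `C = 1 ⊗ diag(bᵢ/aᵢ) ⊗ 1`). [cite: Weil1964, Chap. III n° 41 Lemme 5 p. 194; Kudla1984, §1; GelbartRogawski1991, §3.1 Remark p. 457] -/
theorem hasThetaMajorants_cmConjLineRepRaw₀ :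
    HasThetaMajorants fun (p : CMAdelic L dV × CMAdelic L (lineVec L (b 0)))
      (Φ : piSchwartzBruhat (↥(maximalRealSubfield L)) (Fin N × Fin 1)) =>
        cmConjLineRepRaw₀ L e e₁ dV hdV hdV0 a ha ha0 b hb hb0 g₀ hg₀ hGR hGR₀ hGR₁ p Φ :=
  hasThetaMajorants_seesawConjRep₁ (↥(maximalRealSubfield L)) L (IsCMField.complexConj L) N 1 1 e e₁ e₁ (Matrix.diagonal dV)
    (Matrix.diagonal a) (Matrix.diagonal (lineVec L (b 0))) (Matrix.diagonal (lineVec L (b 1)))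
    (complexConj_imagUnit L) (imagUnit_ne_zero L) (imagUnit_mul_self L)
    (realDiagonal_isSymm L dV hdV) (realDiagonal_isSymm L a ha)
    (realDiagonal_isSymm L (lineVec L (b 0)) fun _ => hb 0) (realDiagonal_isSymm L (lineVec L (b 1)) fun _ => hb 1)
    (isUnit_det_realDiagonal L dV hdV hdV0) (isUnit_det_realDiagonal L a ha ha0)
    (isUnit_det_realDiagonal L (lineVec L (b 0)) (fun _ => hb 0) fun _ => hb0 0)
    (isUnit_det_realDiagonal L (lineVec L (b 1)) (fun _ => hb 1) fun _ => hb0 1)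
    ((Matrix.isUnit_iff_isUnit_det _).1
      (isUnit_kronecker_map (↥(maximalRealSubfield L)) N (isUnit_det_realDiagonal L dV hdV hdV0)
        (isUnit_det_realDiagonal L a ha ha0)))
    (realDiagonal_map L dV hdV).symm (realDiagonal_map L a ha).symm
    (realDiagonal_map L (lineVec L (b 0)) fun _ => hb 0).symm (realDiagonal_map L (lineVec L (b 1)) fun _ => hb 1).symm
    (val_toAdeleGL L g₀) (adelicIsometry_conj L a b g₀ hg₀) (coe_gramConj L a ha ha0 b hb hb0)
    (gramIntertwiner_conj L a ha ha0 b hb hb0 (realDiagonal L dV hdV))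
    (splittingOf_isCompatible _ _ _ _ _ _ _ _ _ _ _ _ _ _ _ _ _ hGR)
    (splittingOf_isCompatible _ _ _ _ _ _ _ _ _ _ _ _ _ _ _ _ _ hGR₀)
    (splittingOf_isCompatible _ _ _ _ _ _ _ _ _ _ _ _ _ _ _ _ _ hGR₁) hρ hρ₀ hρ₁

include hρ hρ₀ hρ₁ in
/-- **`hM₄` at the conjugated CM data — Weil majorants for `ω₁″ = cmConjLineRepRaw₁`.**
[cite: Weil1964, Chap. III n° 41 Lemme 5 p. 194; Kudla1984, §1; GelbartRogawski1991, §3.1 Remark p. 457] -/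
theorem hasThetaMajorants_cmConjLineRepRaw₁ :
    HasThetaMajorants fun (p : CMAdelic L dV × CMAdelic L (lineVec L (b 1)))
      (Φ : piSchwartzBruhat (↥(maximalRealSubfield L)) (Fin N × Fin 1)) =>
        cmConjLineRepRaw₁ L e e₁ dV hdV hdV0 a ha ha0 b hb hb0 g₀ hg₀ hGR hGR₀ hGR₁ p Φ :=
  hasThetaMajorants_seesawConjRep₂ (↥(maximalRealSubfield L)) L (IsCMField.complexConj L) N 1 1 e e₁ e₁ (Matrix.diagonal dV)
    (Matrix.diagonal a) (Matrix.diagonal (lineVec L (b 0))) (Matrix.diagonal (lineVec L (b 1)))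
    (complexConj_imagUnit L) (imagUnit_ne_zero L) (imagUnit_mul_self L)
    (realDiagonal_isSymm L dV hdV) (realDiagonal_isSymm L a ha)
    (realDiagonal_isSymm L (lineVec L (b 0)) fun _ => hb 0) (realDiagonal_isSymm L (lineVec L (b 1)) fun _ => hb 1)
    (isUnit_det_realDiagonal L dV hdV hdV0) (isUnit_det_realDiagonal L a ha ha0)
    (isUnit_det_realDiagonal L (lineVec L (b 0)) (fun _ => hb 0) fun _ => hb0 0)
    (isUnit_det_realDiagonal L (lineVec L (b 1)) (fun _ => hb 1) fun _ => hb0 1)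
    ((Matrix.isUnit_iff_isUnit_det _).1
      (isUnit_kronecker_map (↥(maximalRealSubfield L)) N (isUnit_det_realDiagonal L dV hdV hdV0)
        (isUnit_det_realDiagonal L a ha ha0)))
    (realDiagonal_map L dV hdV).symm (realDiagonal_map L a ha).symm
    (realDiagonal_map L (lineVec L (b 0)) fun _ => hb 0).symm (realDiagonal_map L (lineVec L (b 1)) fun _ => hb 1).symm
    (val_toAdeleGL L g₀) (adelicIsometry_conj L a b g₀ hg₀) (coe_gramConj L a ha ha0 b hb hb0)
    (gramIntertwiner_conj L a ha ha0 b hb hb0 (realDiagonal L dV hdV))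
    (splittingOf_isCompatible _ _ _ _ _ _ _ _ _ _ _ _ _ _ _ _ _ hGR)
    (splittingOf_isCompatible _ _ _ _ _ _ _ _ _ _ _ _ _ _ _ _ _ hGR₀)
    (splittingOf_isCompatible _ _ _ _ _ _ _ _ _ _ _ _ _ _ _ _ _ hGR₁) hρ hρ₀ hρ₁

include hρ hρ₀ hρ₁ in
/-- **Weil majorants for `cmConjLineRep₀ η₀ = η₀ • (ω₀″ ∘ (id × centre))`**, `η₀` with continuous values.
[cite: Weil1964, Chap. III n° 41 Lemme 5 p. 194; GelbartRogawski1991, §3.1 Remark p. 457 L4–13] -/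
theorem hasThetaMajorants_cmConjLineRep₀ (hη₀ : Continuous fun p => ((η₀ p : ℂˣ) : ℂ)) :
    HasThetaMajorants fun (p : CMAdelic L dV × CMAdelicOne L)
      (Φ : piSchwartzBruhat (↥(maximalRealSubfield L)) (Fin N × Fin 1)) =>
        cmConjLineRep₀ L e e₁ dV hdV hdV0 a ha ha0 b hb hb0 g₀ hg₀ hGR hGR₀ hGR₁ η₀ p Φ :=
  hasThetaMajorants_twist_comp_center L dV (lineVec L (b 0))
    (hasThetaMajorants_cmConjLineRepRaw₀ L e e₁ dV hdV hdV0 a ha ha0 b hb hb0 g₀ hg₀ hGR hGR₀ hGR₁ hρ hρ₀ hρ₁) η₀ hη₀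

include hρ hρ₀ hρ₁ in
/-- **Weil majorants for `cmConjLineRep₁ η₁ = η₁ • (ω₁″ ∘ (id × centre))`**, `η₁` with continuous values.
[cite: Weil1964, Chap. III n° 41 Lemme 5 p. 194; GelbartRogawski1991, §3.1 Remark p. 457 L4–13] -/
theorem hasThetaMajorants_cmConjLineRep₁ (hη₁ : Continuous fun p => ((η₁ p : ℂˣ) : ℂ)) :
    HasThetaMajorants fun (p : CMAdelic L dV × CMAdelicOne L)
      (Φ : piSchwartzBruhat (↥(maximalRealSubfield L)) (Fin N × Fin 1)) =>
        cmConjLineRep₁ L e e₁ dV hdV hdV0 a ha ha0 b hb hb0 g₀ hg₀ hGR hGR₀ hGR₁ η₁ p Φ :=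
  hasThetaMajorants_twist_comp_center L dV (lineVec L (b 1))
    (hasThetaMajorants_cmConjLineRepRaw₁ L e e₁ dV hdV hdV0 a ha ha0 b hb hb0 g₀ hg₀ hGR hGR₀ hGR₁ hρ hρ₀ hρ₁) η₁ hη₁

include hρ hρ₀ hρ₁ in
/-- **Weil majorants for `cmConjLineRepFin₀ η₀`** on `U(diag dV)(𝔸) × ker N_{L/L⁺}` acting on `𝒮(𝔸^{n₁})`.
[cite: Weil1964, Chap. III n° 41 Lemme 5 p. 194; GelbartRogawski1991, §3.1 Remark p. 457 L4–13] -/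
theorem hasThetaMajorants_cmConjLineRepFin₀ (hη₀ : Continuous fun p => ((η₀ p : ℂˣ) : ℂ)) :
    HasThetaMajorants fun (p : CMAdelic L dV × ↥(relNormOneIdeles (↥(maximalRealSubfield L)) L))
      (φ : piSchwartzBruhat (↥(maximalRealSubfield L)) (Fin n₁)) =>
        cmConjLineRepFin₀ L e e₁ dV hdV hdV0 a ha ha0 b hb hb0 g₀ hg₀ hGR hGR₀ hGR₁ η₀ p φ :=
  hasThetaMajorants_reindexConj_comp_relNormOne L e₁ dV
    (hasThetaMajorants_cmConjLineRep₀ L e e₁ dV hdV hdV0 a ha ha0 b hb hb0 g₀ hg₀ hGR hGR₀ hGR₁ η₀ hρ hρ₀ hρ₁ hη₀)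

include hρ hρ₀ hρ₁ in
/-- **Weil majorants for `cmConjLineRepFin₁ η₁`** on `U(diag dV)(𝔸) × ker N_{L/L⁺}` acting on `𝒮(𝔸^{n₁})`.
[cite: Weil1964, Chap. III n° 41 Lemme 5 p. 194; GelbartRogawski1991, §3.1 Remark p. 457 L4–13] -/
theorem hasThetaMajorants_cmConjLineRepFin₁ (hη₁ : Continuous fun p => ((η₁ p : ℂˣ) : ℂ)) :
    HasThetaMajorants fun (p : CMAdelic L dV × ↥(relNormOneIdeles (↥(maximalRealSubfield L)) L))
      (φ : piSchwartzBruhat (↥(maximalRealSubfield L)) (Fin n₁)) =>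
        cmConjLineRepFin₁ L e e₁ dV hdV hdV0 a ha ha0 b hb hb0 g₀ hg₀ hGR hGR₀ hGR₁ η₁ p φ :=
  hasThetaMajorants_reindexConj_comp_relNormOne L e₁ dV
    (hasThetaMajorants_cmConjLineRep₁ L e e₁ dV hdV hdV0 a ha ha0 b hb hb0 g₀ hg₀ hGR hGR₀ hGR₁ η₁ hρ hρ₀ hρ₁ hη₁)

/-! ## §2 No majorant hypothesis left -/

/-- **WEIL MAJORANTS FOR `cmConjLineRepFin₀ η₀` FROM SIGN FACTS** — `V` of signature `(N−1,1)`/`(1,N−1)` and the FIRST plane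
`diag(a₀,a₁)` definite through `ι₁`, `V` definite through every other complex embedding, `η₀` with continuous values; nothing is
asked of the second plane `diag(b)` (a line has a strict sign through every embedding).
[cite: Weil1964, Chap. III n° 41 Lemme 5 p. 194, Théorème 6 (1) p. 193; GelbartRogawski1991, §3.1 Prop. 3.1.1 p. 455, Remark p. 457] -/
theorem hasThetaMajorants_cmConjLineRepFin₀_of_signs (ι₁ : L →+* ℂ)
    (h₁V : ∃ i₀ : Fin N, (∀ i, i ≠ i₀ → 0 < (ι₁ (dV i)).re) ∨ ∀ i, i ≠ i₀ → (ι₁ (dV i)).re < 0)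
    (h₁W : (∀ j, 0 < (ι₁ (a j)).re) ∨ ∀ j, (ι₁ (a j)).re < 0)
    (hV : ∀ τ : L →+* ℂ, InfinitePlace.mk τ ≠ InfinitePlace.mk ι₁ →
      (∀ i, 0 < (τ (dV i)).re) ∨ ∀ i, (τ (dV i)).re < 0)
    (hη₀ : Continuous fun p => ((η₀ p : ℂˣ) : ℂ)) :
    HasThetaMajorants fun (p : CMAdelic L dV × ↥(relNormOneIdeles (↥(maximalRealSubfield L)) L))
      (φ : piSchwartzBruhat (↥(maximalRealSubfield L)) (Fin n₁)) =>
        cmConjLineRepFin₀ L e e₁ dV hdV hdV0 a ha ha0 b hb hb0 g₀ hg₀ hGR hGR₀ hGR₁ η₀ p φ :=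
  hasThetaMajorants_cmConjLineRepFin₀ L e e₁ dV hdV hdV0 a ha ha0 b hb hb0 g₀ hg₀ hGR hGR₀ hGR₁ η₀
    (hasThetaMajorants_cmPairSplitting_of_signs_two L e dV hdV hdV0 a ha ha0 ι₁ hGR h₁V h₁W hV)
    (hasThetaMajorants_omega_pairSmall₁_lineVec_of_signs L e₁ dV hdV hdV0 (b 0) (hb 0) (hb0 0) hGR₀ ι₁ h₁V hV)
    (hasThetaMajorants_omega_pairSmall₂_lineVec_of_signs L e₁ dV hdV hdV0 (b 1) (hb 1) (hb0 1) hGR₁ ι₁ h₁V hV) hη₀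

/-- **WEIL MAJORANTS FOR `cmConjLineRepFin₁ η₁` FROM SIGN FACTS.**
[cite: Weil1964, Chap. III n° 41 Lemme 5 p. 194, Théorème 6 (1) p. 193; GelbartRogawski1991, §3.1 Prop. 3.1.1 p. 455, Remark p. 457] -/
theorem hasThetaMajorants_cmConjLineRepFin₁_of_signs (ι₁ : L →+* ℂ)
    (h₁V : ∃ i₀ : Fin N, (∀ i, i ≠ i₀ → 0 < (ι₁ (dV i)).re) ∨ ∀ i, i ≠ i₀ → (ι₁ (dV i)).re < 0)
    (h₁W : (∀ j, 0 < (ι₁ (a j)).re) ∨ ∀ j, (ι₁ (a j)).re < 0)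
    (hV : ∀ τ : L →+* ℂ, InfinitePlace.mk τ ≠ InfinitePlace.mk ι₁ →
      (∀ i, 0 < (τ (dV i)).re) ∨ ∀ i, (τ (dV i)).re < 0)
    (hη₁ : Continuous fun p => ((η₁ p : ℂˣ) : ℂ)) :
    HasThetaMajorants fun (p : CMAdelic L dV × ↥(relNormOneIdeles (↥(maximalRealSubfield L)) L))
      (φ : piSchwartzBruhat (↥(maximalRealSubfield L)) (Fin n₁)) =>
        cmConjLineRepFin₁ L e e₁ dV hdV hdV0 a ha ha0 b hb hb0 g₀ hg₀ hGR hGR₀ hGR₁ η₁ p φ :=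
  hasThetaMajorants_cmConjLineRepFin₁ L e e₁ dV hdV hdV0 a ha ha0 b hb hb0 g₀ hg₀ hGR hGR₀ hGR₁ η₁
    (hasThetaMajorants_cmPairSplitting_of_signs_two L e dV hdV hdV0 a ha ha0 ι₁ hGR h₁V h₁W hV)
    (hasThetaMajorants_omega_pairSmall₁_lineVec_of_signs L e₁ dV hdV hdV0 (b 0) (hb 0) (hb0 0) hGR₀ ι₁ h₁V hV)
    (hasThetaMajorants_omega_pairSmall₂_lineVec_of_signs L e₁ dV hdV hdV0 (b 1) (hb 1) (hb0 1) hGR₁ ι₁ h₁V hV) hη₁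

end CMLinesConj

end UnitaryDualPair

end Literature.NumberTheory.GelbartRogawski1991

end

/-! ### Build-lane note (ops-buildfix G11b-3 recipe v2, LEDGER B13-1/B14-5/B14-7, 2026-08-22)
`lean -o` (the hub build lane, never `lean`/the gate check) runs Lean 4.32's library-suggestion indexers
(`Lean.LibrarySuggestions.SymbolFrequency` / `SineQuaNon`, from their `exportEntriesFn`) over the statement of every local
theorem constant that is not a denied premise; on this family's statements (very large dependent binder telescopes) that fold
runs for tens of minutes (incident G11b-3, run/shared/lean/ops/buildfix/G11b-3-DOSSIER.md). `isDeniedPremise` skips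
`[implicit_reducible]` constants before any fold, and the status is inert on theorems (Meta never unfolds `thmInfo`).
v2 form: ONE file-final, top-level `local` attribute — it goes through the synchronous scoped reducibility extension that
`getReducibilityStatusCore` reads first, so it needs no `set_option Elab.async false` (parallel elaboration stays on), also
reaches auto-realized `*.congr_simp` / structure-projection theorem constants, is never popped before export, and is not
exported. No statement or proof is changed. -/
set_option allowUnsafeReducibility true in
attribute [local implicit_reducible]
  Literature.NumberTheory.GelbartRogawski1991.UnitaryDualPair.hasThetaMajorants_cmConjLineRepRaw₀
  Literature.NumberTheory.GelbartRogawski1991.UnitaryDualPair.hasThetaMajorants_cmConjLineRepRaw₁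
  Literature.NumberTheory.GelbartRogawski1991.UnitaryDualPair.hasThetaMajorants_cmConjLineRep₀
  Literature.NumberTheory.GelbartRogawski1991.UnitaryDualPair.hasThetaMajorants_cmConjLineRep₁
  Literature.NumberTheory.GelbartRogawski1991.UnitaryDualPair.hasThetaMajorants_cmConjLineRepFin₀
  Literature.NumberTheory.GelbartRogawski1991.UnitaryDualPair.hasThetaMajorants_cmConjLineRepFin₁
  Literature.NumberTheory.GelbartRogawski1991.UnitaryDualPair.hasThetaMajorants_cmConjLineRepFin₀_of_signs
  Literature.NumberTheory.GelbartRogawski1991.UnitaryDualPair.hasThetaMajorants_cmConjLineRepFin₁_of_signs
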